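import Literature.NumberTheory.PAdicHodge.DeRhamInducedRepresentation
import Literature.NumberTheory.PAdicHodge.CyclotomicPowersLabelledWeightsBdR
import Literature.NumberTheory.PAdicHodge.BdRFiniteImage
import Literature.NumberTheory.GaloisRepresentations.LabelledWeightsTateTwist
import Literature.NumberTheory.GaloisRepresentations.LabelledWeightsDeRhamRank
import Literature.NumberTheory.GaloisRepresentations.FrobeniusDensityOneProofs
import Literature.NumberTheory.GaloisRepresentations.TateTwistFrobeniusProofs
import Literature.NumberTheory.GaloisRepresentations.CyclotomicPowerTwistProofs
import Literature.NumberTheory.GaloisRepresentations.LocalKroneckerWeberInertiaProofs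
import Literature.NumberTheory.GaloisRepresentations.FramedRepTwistTraceLocalProofs
import Literature.NumberTheory.GaloisRepresentations.WeakAbelianDirectSummandCyclotomicProofs
import Literature.NumberTheory.GaloisRepresentations.AlgebraicHeckeCharacterNormValues
import Literature.NumberTheory.GaloisRepresentations.HeckeCharacterDictionary
import Literature.NumberTheory.GaloisRepresentations.HeckeCharacterOfRayClass
import Literature.NumberTheory.GaloisRepresentations.HeckeCharacterWeakApproximation
import HarnessLib

/-!
# Discharge of the named fact `labelledHodgeTateWeightsAt_induce_of_parallel`
# (Patrikis 2019, proof of Cor. 2.2.3, Lemma 2.2.4, Lemma 7.2.1; Serre 1968, Ch. III)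

Sibling proof file of `Literature/NumberTheory/PAdicHodge/DeRhamInducedRepresentation.lean`
(D-0014): it proves

* `labelledHodgeTateWeightsAt_induce_of_parallel_holds : labelledHodgeTateWeightsAt_induce_of_parallel`
  — for a number field `K` of degree `d`, a prime `ℓ`, a continuous character
  `θ : Γ_K → GL₁(ℚ̄_ℓ)` with `θ(Frob_w^{arith}) = ι⁻¹(χ(ϖ_w))⁻¹` at almost all places `w` for a Hecke
  character `χ` of infinity type `(p, q)` ALL of whose embedding exponents `n_φ` equal `n₀`, the
  `τ`-labelled Hodge–Tate weights of `Ind_{Γ_K}^{Γ_ℚ} θ` at every place `v ∣ ℓ` of `ℚ`, for every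
  continuous label `τ : ℚ_v → ℚ̄_ℓ` and for Fontaine's PINNED datum `fontainePstAdicCompletion v ℓ hv`,
  are `{n₀, …, n₀}` (`d` times).

Theorems only: no definition, no named fact, no `sorry`.

## The printed argument

Patrikis, *Variations on a theorem of Tate* (arXiv:1207.6724): proof of Cor. 2.2.3 (for the
`ℓ`-adic character `ψ̂` of a type-`A₀` Hecke character `ψ` one has `HT_τ(ψ̂) = k_τ`, the exponent of
the embedding matched with the label `τ`), Lemma 2.2.4 (parallel weights), Lemma 7.2.1
(`D_dR(Ind W)` is `D_dR(W)` with the labels forgotten, so `HT_τ(Ind_K^ℚ θ) = ⊔_{τ̃ ∣ τ} HT_τ̃(θ)`);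
Serre, *Abelian ℓ-adic representations* (1968), Ch. III §1.1 (over `ℚ` the locally algebraic
characters are `ε_ℓ^m` up to finite order), §2.3, App. A.5.  With all `k_τ` equal to `n₀`, every
labelled weight of `Ind θ` is `n₀`.

## The tree proof (same conclusion, through what the tree has proved)

When ALL exponents are equal the character `θ` is, up to a character of finite image, the power
`ε_ℓ^{-n₀}` of the cyclotomic character — this special case needs neither Lubin–Tate theory nor the
filtered form of Lemma 7.2.1, and every step is a proved theorem of the tree:

1. **Weil: a parallel type is a norm power up to finite order** (§6).  `n_φ = n₀` for all `φ` means
   `p_w + q_w = n₀` at real and `p_w = q_w = n₀` at complex places, so `χ ‖·‖^{n₀}` has infinity type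
   `(0, 0)` (`HasInfinityType.mul_normCharacter_zpow_of_embExponent_eq`; the type of `‖·‖` is
   `(-1; 0 / -1)`, `hasInfinityType_normCharacter`), hence finite order (Neukirch VII (6.9), (6.14):
   a ray class character modulo a module of definition; `HasInfinityType.isFiniteOrder_of_zero`), and
   `(χ(ϖ_w) (N w)^{-n₀})^N = 1` at every `w` (`‖ϖ_w‖ = (N w)⁻¹`).
2. **Frobenius rigidity** (§7).  At almost all `w`,
   `det (θ ⊗ ε_ℓ^{n₀})(Frob_w)^N = (ι⁻¹(χ(ϖ_w))⁻¹ (N w)^{n₀})^N = 1` (`ε_ℓ(Frob_w) = N w`, accepted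
   `coe_apply_of_isArithFrobAt_of_cyclotomic_zpow`), so `det (θ ⊗ ε_ℓ^{n₀})^N = 1` on `Γ_K` by the
   accepted rigidity along a density-one set of places
   (`MonoidHom.eq_one_of_frobenius_eq_one_of_hasDirichletDensity_one`, Frobenius' density theorem),
   and `θ₀ = θ ⊗ ε_ℓ^{n₀}` has finite image (finitely many `N`-th roots of unity).
3. **Projection formula** (§5).  In the matrix form of `Ind`,
   `Ind(θ₀ ⊗ ε_ℓ^{-n₀}|_{Γ_K}) = D (Ind(θ₀) ⊗ ε_ℓ^{-n₀}) D⁻¹` with `D = diag(ε(rᵢ))`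
   (`FramedRep.induce_twist_comp_eq_conj`, `ε_ℓ ∘ res = ε_ℓ`, accepted
   `cyclotomicCharacter_absGaloisRestrict`), and `D Ind(θ₀) D⁻¹` has finite image
   (`finite_range_induce`, `finite_range_conj`).
4. **Tate twists shift the labelled weights of THE datum by `n₀`** (accepted
   `labelledHodgeTateWeightsAt_twist_of_cyclotomic_zpow`, Fontaine Exp. III Prop. 1.5.2).
5. **Finite-image representations have all labelled weights `0` for `B_dR`** (§1–§4).  For a normal
   subgroup `H ≤ Γ_F` of finite index, `B^H ⊆ F̄`: for `b ∈ B^H`, `∏_{gH} (X - g b)` has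
   `Γ_F`-invariant coefficients, i.e. coefficients in `B^{Γ_F} = F`, it kills `b` and splits in `F̄`,
   and `B` is a domain (`PeriodRingData.mem_range_of_forall_mem_smul_eq`, with Fontaine's section
   `F̄ ↪ B_dR⁺`, `algClosureToBdR`).  Hence `D(ρ) ⊆ ℚ̄_ℓⁿ ⊗ F̄` coordinatewise for `ρ` trivial on `H`
   (`coeffD_le_range_of_forall_mem`), and `F̄ ⊆ Fil⁰`, `F̄ ∩ Fil¹ = 0` (`θ_{dR}` is injective on `F̄`),
   so `Fil⁰ D_τ = D_τ`, `Fil¹ D_τ = 0` and `HT_τ(ρ) = {0}^{dim D_τ} = {0}ⁿ`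
   (`labelledHodgeTateWeights_bdR_of_apply_eq_one`; `dim D_τ = n` because finite-image
   representations are de Rham for THE datum, accepted `fontainePst_isDeRhamFramed_of_finite_range`
   and `fontainePst_finiteDimensional_labelD_and_finrank_eq`).  This is Fontaine 1994, Exp. III
   §1.5–1.6 (`P̄`-admissible representations) for the genuine `B_dR(F)` of the tree.

The assembly is `labelledHodgeTateWeightsAt_induce_eq_replicate_of_embExponent_eq`, stated over an
arbitrary base number field `K₀ ⊆ K` (the fact is the case `K₀ = ℚ`).

## References

* [Patrikis2019] S. Patrikis, *Variations on a theorem of Tate*, Mem. Amer. Math. Soc. 258 (2019),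
  no. 1238 (arXiv:1207.6724): §2.1 Lemma 2.1.1–2.1.3, §2.2 Prop. 2.2.1, Cor. 2.2.3 (proof),
  Lemma 2.2.4, §2.3.1, §2.7.1, §7.2 Lemma 7.2.1.
* [SerreAbelianLadic1968] J.-P. Serre, *Abelian ℓ-adic representations and elliptic curves* (1968),
  Ch. I §1.2 (`χ_ℓ(Frob_v) = N v`), Ch. II §2.3 (`‖·‖`), Ch. III §1.1, §2.3, App. A.5.
* [Weil1956] A. Weil, *On a certain type of characters of the idèle-class group of an algebraic
  number-field* (1956), §1.
* [NeukirchANT1999] J. Neukirch, *Algebraic Number Theory* (1999), Ch. VII §6 Prop. (6.9),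
  Cor. (6.14).
* [FontaineAsterisque223III] J.-M. Fontaine, Astérisque 223 (1994), Exp. II §1.5.3, Exp. III
  §1.5–1.6 and Prop. 1.5.2.
* [SerreLinearRepresentations1977] J.-P. Serre, *Linear representations of finite groups*, GTM 42
  (1977), §3.3 (matrix form of `Ind`, Example: `Ind(ρ ⊗ Res η) ≅ Ind(ρ) ⊗ η`), §7.2.
* [Marcus2018] D. A. Marcus, *Number Fields*, Ch. 7 (Frobenius' density theorem).
-/

noncomputable section

open scoped TensorProduct NumberField Polynomial
open TensorProduct Module Field Polynomial

namespace Literature.NumberTheory.GaloisRepresentations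

namespace PeriodRingData

universe u v v' w

-- Mathlib's own global value of `maxSynthPendingDepth` (see `LabelledWeightsTwist`); the large
-- tensor types also need a higher instance-synthesis budget.
set_option maxSynthPendingDepth 3
set_option synthInstance.maxHeartbeats 200000

/-! ### §1 Invariants of a finite-index subgroup of `Γ` in a period ring are algebraic over `F` -/

section Algebraic

variable {Γ : Type u} [Group Γ] {P : Type v} {F : Type v'} [Field P] [Field F] [Algebra P F]
  (𝔅 : PeriodRingData.{u, v, v', w} Γ P F)

/-- **The invariants `B^H` of a normal subgroup `H ≤ Γ` of finite index lie in the image of any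
algebraically closed field `L ⊇ F` mapping to `B` over `F`.**  For `b ∈ B^H` the polynomial
`∏_{gH ∈ Γ/H} (X - g b) ∈ B[X]` is `Γ`-invariant coefficientwise, hence has coefficients in
`B^Γ = F`; it kills `b`, splits in `L`, and `B` is a domain, so `b` is the image of one of its roots
in `L`.  (For `B = B_dR(F)`, `L = F̄`: `B_dR(F)^{Gal(F̄/F')} ⊆ F̄` for every finite `F'/F`.)
[cite: FontaineAsterisque223III, Exp. III §1.5] -/
theorem mem_range_of_forall_mem_smul_eq (H : Subgroup Γ) [H.Normal] [H.FiniteIndex]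
    {L : Type*} [Field L] [IsAlgClosed L] [Algebra F L] (ι : L →+* 𝔅.B)
    (hι : ι.comp (algebraMap F L) = algebraMap F 𝔅.B) {b : 𝔅.B} (hb : ∀ σ ∈ H, σ • b = b) :
    b ∈ Set.range ι := by
  classical
  haveI : Fintype (Γ ⧸ H) := Fintype.ofFinite _
  -- `g • b` only depends on the coset `g H`
  have hwd : ∀ g g' : Γ, (g : Γ ⧸ H) = g' → g • b = g' • b := by
    intro g g' hgg'
    have hmem : g⁻¹ * g' ∈ H := QuotientGroup.eq.1 hgg'
    have h1 : (g⁻¹ * g') • b = b := hb _ hmem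
    calc g • b = g • ((g⁻¹ * g') • b) := by rw [h1]
      _ = g' • b := by rw [smul_smul, mul_inv_cancel_left]
  -- the polynomial `∏ (X - g b)` over the cosets
  set f : Γ ⧸ H → 𝔅.B := fun q => q.out • b with hf
  have hfq : ∀ g : Γ, f (g : Γ ⧸ H) = g • b := fun g => hwd _ _ (QuotientGroup.out_eq' _)
  set Pb : 𝔅.B[X] := ∏ q : Γ ⧸ H, (X - C (f q)) with hPb
  have hmonic : Pb.Monic := monic_prod_of_monic _ _ fun q _ => monic_X_sub_C _
  -- `Pb` is `Γ`-invariant coefficientwise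
  have hinv : ∀ σ : Γ, Pb.map (MulSemiringAction.toRingHom Γ 𝔅.B σ) = Pb := by
    intro σ
    have hσf : ∀ q : Γ ⧸ H, σ • f q = f (σ • q) := fun q => by
      show σ • (q.out • b) = f (σ • q)
      rw [← MulAction.Quotient.coe_smul_out H σ q, hfq, smul_eq_mul, mul_smul]
    rw [hPb, Polynomial.map_prod]
    simp only [Polynomial.map_sub, Polynomial.map_X, Polynomial.map_C,
      MulSemiringAction.toRingHom_apply, hσf]
    exact Fintype.prod_equiv (MulAction.toPerm σ) (fun q => X - C (f (σ • q)))
      (fun q => X - C (f q)) fun q => rfl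
  -- hence `Pb` has coefficients in `B^Γ = F`: `Pb = P₀.map (F → B)`
  have hlifts : Pb ∈ Polynomial.lifts (algebraMap F 𝔅.B) := by
    refine (Polynomial.lifts_iff_coeff_lifts Pb).2 fun k => ?_
    have hk : Pb.coeff k ∈ {c : 𝔅.B | ∀ σ : Γ, σ • c = c} := fun σ => by
      have h := congrArg (fun Q : 𝔅.B[X] => Q.coeff k) (hinv σ)
      simpa only [Polynomial.coeff_map, MulSemiringAction.toRingHom_apply] using h
    rwa [𝔅.invariants_eq] at hk
  obtain ⟨P₀, hP₀, -, hP₀monic⟩ := Polynomial.lifts_and_degree_eq_and_monic hlifts hmonic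
  -- `b` is a root of `Pb`
  have hroot : b ∈ Pb.roots := by
    rw [Polynomial.mem_roots hmonic.ne_zero, Polynomial.IsRoot.def, hPb, Polynomial.eval_prod]
    refine Finset.prod_eq_zero (Finset.mem_univ ((1 : Γ) : Γ ⧸ H)) ?_
    rw [Polynomial.eval_sub, Polynomial.eval_X, Polynomial.eval_C, hfq, one_smul, sub_self]
  -- `P₀` splits in `L`, and the roots of `Pb = (P₀.map (F → L)).map ι` are images of roots in `L`
  have hmap : (P₀.map (algebraMap F L)).map ι = Pb := by
    rw [Polynomial.map_map, hι, hP₀]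
  have hroots : ((P₀.map (algebraMap F L)).roots).map ι = Pb.roots := by
    rw [← hmap]
    exact Polynomial.roots_map_of_injective_of_card_eq_natDegree ι.injective
      IsAlgClosed.card_roots_eq_natDegree
  rw [← hroots, Multiset.mem_map] at hroot
  obtain ⟨a, -, ha⟩ := hroot
  exact ⟨a, ha⟩

end Algebraic

/-! ### §2 Representations trivial on a subgroup whose invariants are controlled: all weights `0` -/

section Coords

variable {Γ : Type u} [Group Γ] [TopologicalSpace Γ] {P : Type v} {F : Type v'} [Field P]
  [Field F] [Algebra P F]
  {E : Type*} [Field E] [Algebra P E] [TopologicalSpace E]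
  {M : Type*} [AddCommGroup M] [Module E M] [Module P M] [IsScalarTower P E M]
  [TopologicalSpace M]
  (𝔅 : PeriodRingData.{u, v, v', w} Γ P F)

omit [TopologicalSpace Γ] [TopologicalSpace E] [TopologicalSpace M] in
open scoped Classical in
/-- Coordinates of a pure tensor. [folklore] -/
private theorem coords_tmul' (m : M) (b : 𝔅.B) (k : Basis.ofVectorSpaceIndex P M) :
    (TensorProduct.congr (Basis.ofVectorSpace P M).repr (LinearEquiv.refl P 𝔅.B) ≪≫ₗ
      finsuppScalarLeft P 𝔅.B (Basis.ofVectorSpaceIndex P M)) (m ⊗ₜ[P] b) k =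
      (Basis.ofVectorSpace P M).repr m k • b := by
  simp only [LinearEquiv.trans_apply, TensorProduct.congr_tmul, LinearEquiv.refl_apply,
    finsuppScalarLeft_apply_tmul_apply]

omit [TopologicalSpace Γ] [TopologicalSpace E] [TopologicalSpace M] in
open scoped Classical in
/-- The inverse coordinate map on a single coordinate. [folklore] -/
private theorem coords_symm_single' (k : Basis.ofVectorSpaceIndex P M) (b : 𝔅.B) :
    (TensorProduct.congr (Basis.ofVectorSpace P M).repr (LinearEquiv.refl P 𝔅.B) ≪≫ₗ
      finsuppScalarLeft P 𝔅.B (Basis.ofVectorSpaceIndex P M)).symm (Finsupp.single k b) =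
      (Basis.ofVectorSpace P M k) ⊗ₜ[P] b := by
  rw [LinearEquiv.trans_symm, LinearEquiv.trans_apply, finsuppScalarLeft_symm_apply_single,
    TensorProduct.congr_symm_tmul, LinearEquiv.refl_symm, LinearEquiv.refl_apply,
    Basis.repr_symm_single_one]

omit [TopologicalSpace Γ] [TopologicalSpace E] [TopologicalSpace M] in
open scoped Classical in
/-- **A tensor all of whose coordinates lie in the `P`-subspace `N ⊆ B` lies in `M ⊗ N`.** [folklore] -/
private theorem mem_range_of_coords_mem' (N : Submodule P 𝔅.B) (x : M ⊗[P] 𝔅.B)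
    (h : ∀ k, (TensorProduct.congr (Basis.ofVectorSpace P M).repr (LinearEquiv.refl P 𝔅.B) ≪≫ₗ
      finsuppScalarLeft P 𝔅.B (Basis.ofVectorSpaceIndex P M)) x k ∈ N) :
    x ∈ LinearMap.range (AlgebraTensorModule.map (LinearMap.id : M →ₗ[E] M) N.subtype) := by
  set e := TensorProduct.congr (Basis.ofVectorSpace P M).repr (LinearEquiv.refl P 𝔅.B) ≪≫ₗ
    finsuppScalarLeft P 𝔅.B (Basis.ofVectorSpaceIndex P M) with he
  have hx : x = e.symm (e x) := (e.symm_apply_apply x).symm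
  rw [hx, ← Finsupp.sum_single (e x), Finsupp.sum, map_sum]
  refine Submodule.sum_mem _ fun k _ => ?_
  rw [he, coords_symm_single']
  exact ⟨(Basis.ofVectorSpace P M k) ⊗ₜ ⟨e x k, h k⟩, rfl⟩

variable (ρ : ContinuousRep Γ E M)

open scoped Classical in
/-- **An element acting trivially on `M` acts coordinatewise**: if `ρ σ = 1`, the `k`-th coordinate
of `σ • x` (diagonal action on `M ⊗_P B`) is `σ` applied to the `k`-th coordinate of `x`.
[folklore] -/
private theorem coords_coeffTensorRep_of_apply_eq {σ : Γ} (hσ : ∀ v : M, ρ σ v = v)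
    (x : M ⊗[P] 𝔅.B) (k : Basis.ofVectorSpaceIndex P M) :
    (TensorProduct.congr (Basis.ofVectorSpace P M).repr (LinearEquiv.refl P 𝔅.B) ≪≫ₗ
      finsuppScalarLeft P 𝔅.B (Basis.ofVectorSpaceIndex P M)) (𝔅.coeffTensorRep ρ σ x) k =
      σ • (TensorProduct.congr (Basis.ofVectorSpace P M).repr (LinearEquiv.refl P 𝔅.B) ≪≫ₗ
        finsuppScalarLeft P 𝔅.B (Basis.ofVectorSpaceIndex P M)) x k := by
  induction x using TensorProduct.induction_on with
  | zero => rw [map_zero, LinearEquiv.map_zero, Finsupp.zero_apply, smul_zero]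
  | tmul m b =>
    rw [coeffTensorRep_apply_tmul, hσ, coords_tmul', coords_tmul']
    exact (smul_comm σ _ _).symm
  | add x y hx hy =>
    rw [map_add, map_add, Finsupp.add_apply, hx, hy, LinearEquiv.map_add, Finsupp.add_apply, smul_add]

/-- **The invariants of a representation trivial on `H ⊆ Γ` lie in `M ⊗ N` as soon as `B^H ⊆ N`**:
`D(ρ) = (M ⊗_P B)^Γ ⊆ (M ⊗_P B)^H = M ⊗ B^H ⊆ M ⊗ N` (every coordinate of an `H`-invariant tensor is
`H`-invariant).  [cite: FontaineAsterisque223III, Exp. III §1.5] -/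
theorem coeffD_le_range_of_forall_mem (H : Set Γ) (hρ : ∀ σ ∈ H, ∀ v : M, ρ σ v = v)
    (N : Submodule P 𝔅.B) (hN : ∀ b : 𝔅.B, (∀ σ ∈ H, σ • b = b) → b ∈ N) :
    𝔅.coeffD ρ ≤ LinearMap.range (AlgebraTensorModule.map (LinearMap.id : M →ₗ[E] M) N.subtype) := by
  classical
  intro x hx
  refine 𝔅.mem_range_of_coords_mem' _ x fun k => hN _ fun σ hσ => ?_
  rw [← 𝔅.coords_coeffTensorRep_of_apply_eq ρ (hρ σ hσ) x k, hx σ]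

variable (τ : F →+* E)

/-- **`Fil^i D_τ = D_τ` for `i ≤ 0`** when `D(ρ) ⊆ M ⊗ N` with `N ⊆ Fil⁰ B`.
[cite: FontaineAsterisque223III, Exp. III §1.5] -/
theorem labelFilD_eq_labelD_of_le_range {N : Submodule P 𝔅.B}
    (hD : 𝔅.coeffD ρ ≤ LinearMap.range (AlgebraTensorModule.map (LinearMap.id : M →ₗ[E] M) N.subtype))
    (hN0 : N ≤ (𝔅.fil 0).restrictScalars P) {i : ℤ} (hi : i ≤ 0) :
    𝔅.labelFilD ρ τ i = 𝔅.labelD ρ τ := by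
  rw [labelFilD]
  refine inf_eq_left.2 fun x hx => 𝔅.coeffFilTensor_antitone E M hi ?_
  obtain ⟨y, hy⟩ := hD hx.1
  refine ⟨AlgebraTensorModule.map (LinearMap.id : M →ₗ[E] M) (Submodule.inclusion hN0) y, ?_⟩
  rw [← hy, ← LinearMap.comp_apply, ← AlgebraTensorModule.map_comp]
  rfl

/-- **`Fil^i D_τ = 0` for `i ≥ 1`** when `D(ρ) ⊆ M ⊗ N` with `N ∩ Fil¹ B = 0`
(`(M ⊗ N) ∩ (M ⊗ Fil¹) = M ⊗ (N ∩ Fil¹) = 0`, accepted `range_map_subtype_inf_eq_bot`).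
[cite: FontaineAsterisque223III, Exp. III §1.5] -/
theorem labelFilD_eq_bot_of_le_range {N : Submodule P 𝔅.B}
    (hD : 𝔅.coeffD ρ ≤ LinearMap.range (AlgebraTensorModule.map (LinearMap.id : M →ₗ[E] M) N.subtype))
    (hN1 : N ⊓ (𝔅.fil 1).restrictScalars P = ⊥) {i : ℤ} (hi : 1 ≤ i) :
    𝔅.labelFilD ρ τ i = ⊥ := by
  refine eq_bot_iff.2 fun x hx => ?_
  rw [labelFilD] at hx
  have h := 𝔅.range_map_subtype_inf_eq_bot (M := M) (E := E) _ _ hN1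
  rw [← h]
  exact ⟨hD hx.1.1, 𝔅.coeffFilTensor_antitone E M hi hx.2⟩

/-- **All labelled Hodge–Tate weights are `0`** when `D(ρ) ⊆ M ⊗ N` for a `P`-subspace `N ⊆ B`
with `N ⊆ Fil⁰ B` and `N ∩ Fil¹ B = 0`: `HT_τ(ρ) = {0, …, 0}` with multiplicity `dim_E D_τ(ρ)`.
(Applied below with `N = F̄ ⊆ B_dR(F)` and `ρ` of finite image.)
[cite: FontaineAsterisque223III, Exp. III §1.5] [cite: Patrikis2019, §2.3.1] -/
theorem labelledHodgeTateWeights_of_le_range {N : Submodule P 𝔅.B}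
    (hD : 𝔅.coeffD ρ ≤ LinearMap.range (AlgebraTensorModule.map (LinearMap.id : M →ₗ[E] M) N.subtype))
    (hN0 : N ≤ (𝔅.fil 0).restrictScalars P) (hN1 : N ⊓ (𝔅.fil 1).restrictScalars P = ⊥) :
    𝔅.labelledHodgeTateWeights ρ τ = Multiset.replicate (Module.finrank E (𝔅.labelD ρ τ)) 0 := by
  rw [labelledHodgeTateWeights_def, ← jumpMultiset_step]
  congr 1
  funext i
  by_cases hi : i ≤ 0
  · rw [if_pos hi, 𝔅.labelFilD_eq_labelD_of_le_range ρ τ hD hN0 hi]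
  · rw [if_neg hi, 𝔅.labelFilD_eq_bot_of_le_range ρ τ hD hN1 (by omega), finrank_bot]

end Coords

end PeriodRingData

end Literature.NumberTheory.GaloisRepresentations

/-! ### §3 Finite-image representations have all labelled Hodge–Tate weights `0` for `B_dR(F)` -/

namespace Literature.NumberTheory.PAdicHodge

open ValuativeRel WittVector
open Literature.AlgebraicGeometry.Resolution
open Literature.NumberTheory.GaloisRepresentations
open Literature.NumberTheory.GaloisRepresentations.IsNonarchimedeanLocalField

section BdR

-- Mathlib's own global value of `maxSynthPendingDepth` (see `LabelledWeightsTwist`); the large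
-- tensor types also need a higher instance-synthesis budget.
set_option maxSynthPendingDepth 3
set_option synthInstance.maxHeartbeats 200000

variable {F : Type} [Field F] [ValuativeRel F] [TopologicalSpace F] [IsNonarchimedeanLocalField F]
  [CharZero F] {p : ℕ} [Fact p.Prime] [Fact (¬ IsUnit (p : integerC F))]
  [IsAdicComplete (Ideal.span {(p : integerC F)}) (integerC F)] [Algebra ℚ_[p] F]
  (hp : valuation F p < 1)

/-- **`HT_τ(ρ) = {0, …, 0}` for `B_dR(F)` and `ρ : Γ_F →ₜ* GL_n(ℚ̄_p)` trivial on a normal subgroup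
of finite index** (with multiplicity `dim D_τ(ρ)`; every label `τ : F → ℚ̄_p`).  The invariants of
such a subgroup in `B_dR(F)` lie in `F̄ ⊆ B_dR⁺` (`PeriodRingData.mem_range_of_forall_mem_smul_eq`
with Fontaine's section `F̄ ↪ B_dR⁺`, `algClosureToBdR`), and `F̄ ⊆ Fil⁰`, `F̄ ∩ Fil¹ = 0`
(`θ ∘ (F̄ ↪ B_dR⁺)` is the injection `F̄ ⊆ ℂ_F`), so `D(ρ) ⊆ ℚ̄_pⁿ ⊗ F̄` sits in `Fil⁰ ∖ Fil¹`
(Fontaine 1994, Exp. III §1.5–1.6: potentially trivial representations are `F̄`-admissible, hence de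
Rham with `D_dR = (F̄ ⊗ V)^{Γ_F} ⊗_F F`, all of weight `0`).
[cite: FontaineAsterisque223III, Exp. II §1.5.3 and Exp. III §1.5] -/
theorem labelledHodgeTateWeights_bdR_of_apply_eq_one {n : ℕ}
    (ρ : FramedRep (absoluteGaloisGroup F) (PadicAlgCl p) n)
    (H : Subgroup (absoluteGaloisGroup F)) [H.Normal] [H.FiniteIndex] (hρ : ∀ σ ∈ H, ρ σ = 1)
    (τ : F →+* PadicAlgCl p) :
    (bdRPeriodRingData (F := F) (p := p) hp).labelledHodgeTateWeights (FramedRep.toContinuousRep ρ) τ =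
      Multiset.replicate (Module.finrank (PadicAlgCl p)
        ((bdRPeriodRingData (F := F) (p := p) hp).labelD (FramedRep.toContinuousRep ρ) τ)) 0 := by
  have hF : Function.Surjective (fontaineTheta (integerC F) p) := surjective_fontaineTheta_integerC hp
  haveI := isDomain_bDeRhamPlus (F := F) (p := p) hF
  -- Fontaine's section `F̄ → B_dR⁺ ⊆ B_dR`
  set ιB : AlgebraicClosure F →+* (bdRPeriodRingData (F := F) (p := p) hp).B :=
    (algebraMap (BDeRhamPlus (integerC F) p) (FracBdR F p)).comp (algClosureToBdR hp hF) with hιB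
  have hι : ιB.comp (algebraMap F (AlgebraicClosure F)) =
      algebraMap F (bdRPeriodRingData (F := F) (p := p) hp).B :=
    RingHom.ext fun a => algClosureToFracBdR_algebraMap hp a
  -- its image, a `ℚ_p`-subspace of `B_dR`
  let N : Submodule ℚ_[p] (bdRPeriodRingData (F := F) (p := p) hp).B :=
    { carrier := Set.range ιB
      add_mem' := by
        rintro _ _ ⟨x, rfl⟩ ⟨y, rfl⟩
        exact ⟨x + y, map_add _ _ _⟩
      zero_mem' := ⟨0, map_zero _⟩
      smul_mem' := by
        rintro c _ ⟨x, rfl⟩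
        refine ⟨algebraMap F (AlgebraicClosure F) (algebraMap ℚ_[p] F c) * x, ?_⟩
        rw [map_mul, Algebra.smul_def, PeriodRingData.algebraMap_eq, ← RingHom.comp_apply, hι] }
  have hN : ∀ b : (bdRPeriodRingData (F := F) (p := p) hp).B, (∀ σ ∈ H, σ • b = b) → b ∈ N :=
    fun b hb => (bdRPeriodRingData (F := F) (p := p) hp).mem_range_of_forall_mem_smul_eq H ιB hι hb
  -- `F̄ ⊆ Fil⁰`
  have hN0 : N ≤ ((bdRPeriodRingData (F := F) (p := p) hp).fil 0).restrictScalars ℚ_[p] := by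
    rintro _ ⟨x, rfl⟩
    exact algebraMap_mem_fil_zero hp hF _
  -- `F̄ ∩ Fil¹ = 0`
  have hN1 : N ⊓ ((bdRPeriodRingData (F := F) (p := p) hp).fil 1).restrictScalars ℚ_[p] = ⊥ := by
    refine (Submodule.eq_bot_iff _).2 ?_
    rintro _ ⟨⟨x, rfl⟩, hx1⟩
    obtain ⟨b, hb⟩ := (mem_fil_iff hp hF).1 hx1
    have h1 : algClosureToBdR hp hF x = xiBdR * b := by
      refine algebraMap_fracBdR_injective (F := F) (p := p) ?_
      rw [map_mul, ← zpow_one (algebraMap (BDeRhamPlus (integerC F) p) (FracBdR F p) xiBdR)]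
      exact hb
    have h2 : algClosureToC F x = 0 := by
      rw [← thetaBdR_algClosureToBdR hp hF, h1, map_mul, thetaBdR_xiBdR, zero_mul]
    have hx0 : x = 0 := (map_eq_zero_iff _ (algClosureToC F).injective).1 h2
    rw [hx0, map_zero]
  -- `D(ρ) ⊆ ℚ̄_pⁿ ⊗ F̄`
  have hD := (bdRPeriodRingData (F := F) (p := p) hp).coeffD_le_range_of_forall_mem
    (FramedRep.toContinuousRep ρ) (H : Set (absoluteGaloisGroup F))
    (fun σ hσ v => by
      rw [FramedRep.toContinuousRep_apply_apply, hρ σ hσ, Units.val_one, Matrix.one_mulVec]) N hN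
  exact (bdRPeriodRingData (F := F) (p := p) hp).labelledHodgeTateWeights_of_le_range
    (FramedRep.toContinuousRep ρ) τ hD hN0 hN1

end BdR

/-! ### §4 THE pinned datum: `HT_τ(ρ) = {0}ⁿ` for finite-image `ρ`, locally and at `v ∣ p` -/

section Pinned

variable {F : Type} [Field F] [ValuativeRel F] [TopologicalSpace F] [IsNonarchimedeanLocalField F]
  [CharZero F] {p : ℕ} [Fact p.Prime]

/-- **Finite-image `ρ : Γ_F →ₜ* GL_n(ℚ̄_p)` have `HT_τ(ρ) = {0, …, 0}` (`n` times) for THE pinned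
datum `fontainePst F p hp`, unconditionally** (every `ℚ_p`-embedding `τ : F → ℚ̄_p`): the period ring
of the pin IS `B_dR(F)` (`fontainePst_𝔅_eq_bdRPeriodRingData`), finite-image representations are de
Rham for it (`fontainePst_isDeRhamFramed_of_finite_range`) so that `dim D_τ(ρ) = n`
(`fontainePst_finiteDimensional_labelD_and_finrank_eq`), and all weights vanish by
`labelledHodgeTateWeights_bdR_of_apply_eq_one` (the kernel of `ρ` is open of finite index).
[cite: FontaineAsterisque223III, Exp. III §1.5–1.6] [cite: Patrikis2019, §2.7.1] -/
theorem fontainePst_labelledHodgeTateWeights_of_finite_range (hp : valuation F p < 1) {n : ℕ}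
    (ρ : FramedRep (absoluteGaloisGroup F) (PadicAlgCl p) n) (hρ : (Set.range ρ).Finite) :
    letI := (fontainePst F p hp).algebra
    ∀ τ : F →ₐ[ℚ_[p]] PadicAlgCl p,
      (fontainePst F p hp).𝔅.labelledHodgeTateWeights (FramedRep.toContinuousRep ρ) τ.toRingHom =
        Multiset.replicate n 0 := by
  haveI : Fact (¬ IsUnit (p : integerC F)) := ⟨not_isUnit_natCast_integerC hp⟩
  haveI : IsAdicComplete (Ideal.span {(p : integerC F)}) (integerC F) :=
    isAdicComplete_integerC_natCast hp
  letI := (fontainePst F p hp).algebra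
  intro τ
  -- the kernel of `ρ` is a normal subgroup of finite index
  haveI : Finite ρ.toMonoidHom.range := by
    have h : (Set.range ρ.toMonoidHom).Finite := hρ
    exact h.to_subtype
  haveI : ρ.toMonoidHom.ker.FiniteIndex := by
    rw [Subgroup.finiteIndex_iff, Subgroup.index_ker]
    exact Nat.card_pos.ne'
  -- `dim D_τ(ρ) = n` (finite image ⇒ de Rham)
  have hdR : (fontainePst F p hp).IsDeRhamFramed ρ := fontainePst_isDeRhamFramed_of_finite_range hp ρ hρ
  obtain ⟨-, hrank⟩ := fontainePst_finiteDimensional_labelD_and_finrank_eq hp hdR τ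
  have key : (fontainePst F p hp).𝔅.labelledHodgeTateWeights (FramedRep.toContinuousRep ρ) τ.toRingHom =
      Multiset.replicate (Module.finrank (PadicAlgCl p)
        ((fontainePst F p hp).𝔅.labelD (FramedRep.toContinuousRep ρ) τ.toRingHom)) 0 := by
    rw [fontainePst_𝔅_eq_bdRPeriodRingData hp]
    exact labelledHodgeTateWeights_bdR_of_apply_eq_one hp ρ ρ.toMonoidHom.ker (fun σ hσ => hσ)
      τ.toRingHom
  rw [key, hrank]

end Pinned

section NumberField

open IsDedekindDomain

variable {K : Type} [Field K] [NumberField K] {p : ℕ} [Fact p.Prime] {n : ℕ}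

/-- **At a place `v ∣ p` where `ρ : Γ_K →ₜ* GL_n(ℚ̄_p)` has finite local image, all labelled
Hodge–Tate weights of the summit statements vanish**: for THE pinned datum
`fontainePstAdicCompletion v p hv` and every CONTINUOUS label `τ : K_v →+* ℚ̄_p`,
`HT_τ(ρ|_{Γ_{K_v}}) = {0, …, 0}` (`n` times) as soon as `ρ(Γ_{K_v})` is finite (a continuous `τ` is
`ℚ_p`-linear, accepted `adicCompletion_ringHom_commutes_of_continuous`).
[cite: FontaineAsterisque223III, Exp. III §1.5–1.6] [cite: Patrikis2019, §2.7.1] -/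
theorem _root_.Literature.NumberTheory.GaloisRepresentations.FramedGaloisRep.labelledHodgeTateWeightsAt_eq_replicate_zero_of_finite_range
    (ρ : FramedGaloisRep K (PadicAlgCl p) n) (v : HeightOneSpectrum (𝓞 K))
    (hv : ((p : ℕ) : 𝓞 K) ∈ v.asIdeal) (hρ : (Set.range (ρ.toLocal v)).Finite)
    (τ : v.adicCompletion K →+* PadicAlgCl p) (hτ : Continuous τ) :
    ρ.labelledHodgeTateWeightsAt v (fontainePstAdicCompletion v p hv).algebra
      (fontainePstAdicCompletion v p hv).𝔅 τ = Multiset.replicate n 0 := by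
  haveI := LocalField.charZero_adicCompletion v
  letI := (fontainePstAdicCompletion v p hv).algebra
  let τ' : v.adicCompletion K →ₐ[ℚ_[p]] PadicAlgCl p :=
    ⟨τ, adicCompletion_ringHom_commutes_of_continuous v hv τ hτ⟩
  rw [FramedGaloisRep.labelledHodgeTateWeightsAt_def]
  exact fontainePst_labelledHodgeTateWeights_of_finite_range
    (LocalField.valuation_adicCompletion_natCast_lt_one v p hv) (ρ.toLocal v) hρ τ'

end NumberField

end Literature.NumberTheory.PAdicHodge

/-! ### §5 Induction: the projection formula `Ind(ρ ⊗ η|_H) ≅ Ind(ρ) ⊗ η` and finite images -/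

namespace Literature.NumberTheory.GaloisRepresentations

open _root_.Topology

section Framed

variable {H : Type*} {G : Type*} [Group H] [TopologicalSpace H] [Group G] [TopologicalSpace G]
  [IsTopologicalGroup G] {A : Type*} [CommRing A] [TopologicalSpace A] [IsTopologicalRing A]
  {n m : ℕ} {ι : Type*} [Fintype ι] [DecidableEq ι]

namespace FramedRep

/-- **Projection formula `Ind(ρ ⊗ η|_H) = D (Ind(ρ) ⊗ η) D⁻¹`** in the matrix form of `Ind`: for a
continuous character `η` of `G` and its restriction `η_H = η ∘ φ` to `H`, inducing the twist
`ρ ⊗ η_H` gives the twist of `Ind(ρ)` by `η` up to the explicit diagonal change of frame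
`D = diag(η(rᵢ)⁻¹)` (block `(i, j)` of `Ind(ρ ⊗ η_H)(g)` is `η(rᵢ⁻¹ g rⱼ) ρ̇(rᵢ⁻¹ g rⱼ) =
η(rᵢ)⁻¹ η(g) η(rⱼ) ρ̇(rᵢ⁻¹ g rⱼ)`).  Serre, *Linear representations of finite groups*, §3.3
Example 5 / §7.2 (`Ind(ρ ⊗ Res η) ≅ Ind(ρ) ⊗ η`).
[cite: SerreLinearRepresentations1977, §3.3 Thm. 12 (proof)] -/
theorem induce_twist_comp_eq_conj {φ : H →* G} (hφ : IsOpenEmbedding φ) {r : ι → G}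
    (hr : Function.Bijective fun i => (r i : G ⧸ φ.range)) (e : ι × Fin n ≃ Fin m)
    (ρ : FramedRep H A n) (η : G →ₜ* Aˣ) (ηH : H →ₜ* Aˣ) (hη : ∀ h : H, ηH h = η (φ h)) :
    ∃ D : GL (Fin m) A,
      induce φ hφ r hr e (ρ.twist ηH) = ((induce φ hφ r hr e ρ).twist η).conj D := by
  -- the diagonal frame and its inverse
  let D : GL (Fin m) A :=
    { val := Matrix.diagonal fun x => (((η (r (e.symm x).1))⁻¹ : Aˣ) : A)
      inv := Matrix.diagonal fun x => ((η (r (e.symm x).1) : Aˣ) : A)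
      val_inv := by
        rw [Matrix.diagonal_mul_diagonal, ← Matrix.diagonal_one]
        congr 1
        funext x
        rw [Units.inv_mul]
      inv_val := by
        rw [Matrix.diagonal_mul_diagonal, ← Matrix.diagonal_one]
        congr 1
        funext x
        rw [Units.mul_inv] }
  have hD : ((D : GL (Fin m) A) : Matrix (Fin m) (Fin m) A) =
      Matrix.diagonal fun x => (((η (r (e.symm x).1))⁻¹ : Aˣ) : A) := rfl
  have hDinv : (((D⁻¹ : GL (Fin m) A)) : Matrix (Fin m) (Fin m) A) =
      Matrix.diagonal fun x => ((η (r (e.symm x).1) : Aˣ) : A) := rfl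
  refine ⟨D, ContinuousMonoidHom.ext fun g => Units.ext ?_⟩
  rw [conj_apply, Units.val_mul, Units.val_mul, coe_twist_apply, hD, hDinv, induce_apply_coe,
    induce_apply_coe]
  ext x y
  rw [Matrix.mul_diagonal, Matrix.diagonal_mul, Matrix.smul_apply, indFlatHom_apply, indFlatHom_apply]
  set i := (e.symm x).1
  set j := (e.symm y).1
  by_cases hmem : (r i)⁻¹ * g * r j ∈ φ.range
  · obtain ⟨h, hh⟩ := hmem
    have hηg : (η ((r i)⁻¹ * g * r j) : A) = (((η (r i))⁻¹ : Aˣ) : A) * (η g : A) * (η (r j) : A) := by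
      rw [map_mul, map_mul, map_inv, Units.val_mul, Units.val_mul]
    rw [← hh, dotExtend_apply_map hφ.injective, dotExtend_apply_map hφ.injective,
      toMatrixHom_apply, toMatrixHom_apply, coe_twist_apply, Matrix.smul_apply, hη h, hh, hηg,
      smul_eq_mul, smul_eq_mul]
    ring
  · rw [dotExtend_of_not_mem _ _ hmem, dotExtend_of_not_mem _ _ hmem]
    simp

omit [TopologicalSpace H] [TopologicalSpace G] [IsTopologicalGroup G] [TopologicalSpace A]
  [IsTopologicalRing A] [Fintype ι] [DecidableEq ι] in
/-- The entries of the block matrices `Ind(π)(g)` for `π` with values in a finite set of matrices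
lie in a finite set. [folklore] -/
theorem finite_setOf_indMatrix_entry {φ : H →* G} (π : H → Matrix (Fin n) (Fin n) A)
    (hπ : (Set.range π).Finite) (r : ι → G) :
    {a : A | ∃ g i j b c, indMatrix φ π r g i j b c = a}.Finite := by
  classical
  -- all entries of all values of `π̇` lie in the finite set `T`
  set T : Set A := {0} ∪ ⋃ b : Fin n, ⋃ c : Fin n,
    (fun M : Matrix (Fin n) (Fin n) A => M b c) '' Set.range π
  have hT : T.Finite := (Set.finite_singleton 0).union
    (Set.finite_iUnion fun b => Set.finite_iUnion fun c => hπ.image _)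
  refine hT.subset ?_
  rintro _ ⟨g, i, j, b, c, rfl⟩
  rw [indMatrix_apply, dotExtend, Function.extend_def]
  split_ifs with hex
  · right
    simp only [Set.mem_iUnion, Set.mem_image, Set.mem_range]
    exact ⟨b, c, π (Classical.choose hex), ⟨_, rfl⟩, rfl⟩
  · left
    rfl

omit [IsTopologicalRing A] in
/-- **`Ind(ρ)` has finite image when `ρ` has** (its matrix entries lie in a finite set).
[cite: SerreLinearRepresentations1977, §3.3 Thm. 12 (proof)] -/
theorem finite_range_induce {φ : H →* G} (hφ : IsOpenEmbedding φ) {r : ι → G}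
    (hr : Function.Bijective fun i => (r i : G ⧸ φ.range)) (e : ι × Fin n ≃ Fin m)
    (ρ : FramedRep H A n) (hρ : (Set.range ρ).Finite) :
    (Set.range (induce φ hφ r hr e ρ)).Finite := by
  classical
  have hπ : (Set.range (ρ.toMatrixHom : H → Matrix (Fin n) (Fin n) A)).Finite := by
    have h : Set.range (ρ.toMatrixHom : H → Matrix (Fin n) (Fin n) A) =
        (fun u : GL (Fin n) A => (u : Matrix (Fin n) (Fin n) A)) '' Set.range ρ := by
      ext M
      simp only [Set.mem_range, Set.mem_image, toMatrixHom_apply, exists_exists_eq_and]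
    rw [h]
    exact hρ.image _
  set T := {a : A | ∃ g i j b c,
    indMatrix φ (ρ.toMatrixHom : H → Matrix (Fin n) (Fin n) A) r g i j b c = a}
  have hT : T.Finite := finite_setOf_indMatrix_entry _ hπ r
  haveI : Finite T := hT.to_subtype
  -- `Ind(ρ)(g)` is a matrix with entries in `T`
  let Φ : (Fin m → Fin m → T) → Matrix (Fin m) (Fin m) A := fun f => Matrix.of fun x y => (f x y : A)
  have hsub : Set.range ((fun u : GL (Fin m) A => (u : Matrix (Fin m) (Fin m) A)) ∘
      induce φ hφ r hr e ρ) ⊆ Set.range Φ := by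
    rintro _ ⟨g, rfl⟩
    refine ⟨fun x y => ⟨_, g, (e.symm x).1, (e.symm y).1, (e.symm x).2, (e.symm y).2, rfl⟩, ?_⟩
    ext x y
    rfl
  have h1 : ((fun u : GL (Fin m) A => (u : Matrix (Fin m) (Fin m) A)) ''
      Set.range (induce φ hφ r hr e ρ)).Finite := by
    rw [← Set.range_comp]
    exact (Set.finite_range Φ).subset hsub
  exact h1.of_finite_image fun u _ v _ huv => Units.ext huv

omit [TopologicalSpace H] [IsTopologicalGroup G] [Fintype ι] [DecidableEq ι] in
/-- A change of frame preserves finiteness of the image. [folklore] -/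
theorem finite_range_conj (P : GL (Fin n) A) (ρ : FramedRep G A n) (hρ : (Set.range ρ).Finite) :
    (Set.range (ρ.conj P)).Finite := by
  have h : Set.range (ρ.conj P) = (fun g => P * g * P⁻¹) '' Set.range ρ := by
    ext g
    simp only [Set.mem_range, Set.mem_image, conj_apply, exists_exists_eq_and]
  rw [h]
  exact hρ.image _

end FramedRep

end Framed

section Galois

variable (K : Type*) {F : Type*} [Field K] [Field F] [Algebra K F] [CharZero K]
  [FiniteDimensional K F] {A : Type*} [CommRing A] [TopologicalSpace A] [IsTopologicalRing A]
  {n d : ℕ}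

namespace FramedGaloisRep

/-- **Projection formula for `Ind_{Γ_F}^{Γ_K}`**: for a continuous character `η` of `Γ_K` and its
restriction `η_F = η ∘ res` to `Γ_F`, `Ind(ρ ⊗ η_F)` is a conjugate of `Ind(ρ) ⊗ η`.
[cite: SerreLinearRepresentations1977, §3.3 Thm. 12 (proof)] -/
theorem induce_twist_comp_eq_conj (hd : Module.finrank K F = d) (ρ : FramedGaloisRep F A n)
    (η : absoluteGaloisGroup K →ₜ* Aˣ) (ηF : absoluteGaloisGroup F →ₜ* Aˣ)
    (hη : ∀ σ : absoluteGaloisGroup F, ηF σ = η (absGaloisRestrict K F σ)) :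
    ∃ D : GL (Fin (d * n)) A,
      FramedGaloisRep.induce K hd (FramedRep.twist ρ ηF) = ((ρ.induce K hd).twist η).conj D := by
  obtain ⟨D, hD⟩ := FramedRep.induce_twist_comp_eq_conj (isOpenEmbedding_absGaloisRestrict K F)
    (absGaloisCosetRep_bijective K F hd) finProdFinEquiv ρ η ηF hη
  exact ⟨D, by rw [induce_def, induce_def]; exact hD⟩

omit [IsTopologicalRing A] in
/-- **`Ind_{Γ_F}^{Γ_K} ρ` has finite image when `ρ` has.** [folklore] -/
theorem finite_range_induce (hd : Module.finrank K F = d) (ρ : FramedGaloisRep F A n)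
    (hρ : (Set.range ρ).Finite) : (Set.range (ρ.induce K hd)).Finite := by
  rw [induce_def]
  exact FramedRep.finite_range_induce (isOpenEmbedding_absGaloisRestrict K F)
    (absGaloisCosetRep_bijective K F hd) finProdFinEquiv ρ hρ

end FramedGaloisRep

end Galois

end Literature.NumberTheory.GaloisRepresentations

/-! ### §6 Hecke characters: a parallel infinity type is a norm power up to a character of finite order -/

namespace Literature.NumberTheory.GaloisRepresentations

namespace HeckeCharacter

open scoped ComplexConjugate Classical
open Filter IsDedekindDomain NumberField NumberField.InfinitePlace NumberField.InfinitePlace.Completion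

variable {K : Type} [Field K] [NumberField K]

/-- **The infinity type of a product is the sum of the infinity types**: if `χ` has type `(p, q)`
and `ψ` has type `(p', q')` then `χψ` has type `(p + p', q + q')` (on the intersection of the two
neighbourhoods of `1`, `A_{p,q} A_{p',q'} = A_{p+p',q+q'}`).  Weil 1956, §1 (the characters of type
`A₀` form a group). [cite: Weil1956, §1] -/
theorem HasInfinityType.mul {χ ψ : HeckeCharacter K} {p q p' q' : InfinitePlace K → ℤ}
    (hχ : χ.HasInfinityType p q) (hψ : ψ.HasInfinityType p' q') :
    (χ * ψ).HasInfinityType (p + p') (q + q') := by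
  -- the proof of `hasInfinityType_mul` of the prover-side file
  -- `Summits/Langlands/.../IrreducibilityBySelfDualityReciprocityUpToIrreducibilityHeckeParallelNormTwist`
  obtain ⟨U, hU, hχU⟩ := hχ
  obtain ⟨V, hV, hψV⟩ := hψ
  refine ⟨U ∩ V, inter_mem hU hV, fun x hx => ?_⟩
  rw [HeckeCharacter.mul_apply, Units.val_mul, hχU x hx.1, hψV x hx.2,
    HeckeCharacter.archFactor_apply, HeckeCharacter.archFactor_apply,
    HeckeCharacter.archFactor_apply, ← Finset.prod_mul_distrib]
  refine Finset.prod_congr rfl fun w _ => ?_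
  have hz : extensionEmbedding w ((x : InfiniteAdeleRing K) w) ≠ 0 :=
    InfiniteIdele.extensionEmbedding_apply_ne_zero x w
  have hz' : conj (extensionEmbedding w ((x : InfiniteAdeleRing K) w)) ≠ 0 :=
    (map_ne_zero (starRingEnd ℂ)).mpr hz
  simp only [Pi.add_apply, neg_add, zpow_add₀ hz, zpow_add₀ hz']
  ring

/-- `(χ^k)(x) = χ(x)^k` for `k ∈ ℤ` (integer powers of Hecke characters are pointwise). [folklore] -/
theorem zpow_apply (χ : HeckeCharacter K) (k : ℤ) (x : ideleGroup K) :
    (χ ^ k) x = χ x ^ k := by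
  obtain ⟨n, rfl | rfl⟩ := k.eq_nat_or_neg
  · rw [zpow_natCast, zpow_natCast, HeckeCharacter.pow_apply]
  · rw [zpow_neg, zpow_neg, zpow_natCast, zpow_natCast, HeckeCharacter.inv_apply,
      HeckeCharacter.pow_apply]

/-- **Integer powers act on the infinity type exponent-wise**: if `χ` has type `(p, q)` then `χ^k`
has type `(k p, k q)` for every `k ∈ ℤ`.  Weil 1956, §1. [cite: Weil1956, §1] -/
theorem HasInfinityType.zpow {χ : HeckeCharacter K} {p q : InfinitePlace K → ℤ}
    (h : χ.HasInfinityType p q) (k : ℤ) :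
    (χ ^ k).HasInfinityType (fun w => k * p w) (fun w => k * q w) := by
  obtain ⟨U, hU, hχU⟩ := h
  refine ⟨U, hU, fun x hx => ?_⟩
  rw [zpow_apply, Units.val_zpow_eq_zpow_val, hχU x hx, HeckeCharacter.archFactor_apply,
    HeckeCharacter.archFactor_apply, ← Finset.prod_zpow]
  refine Finset.prod_congr rfl fun w _ => ?_
  rw [mul_zpow, ← zpow_mul, ← zpow_mul, show -p w * k = -(k * p w) by ring,
    show -q w * k = -(k * q w) by ring]

/-- **At a real place only the sum `p_w + q_w` of the exponents matters**: if `χ` has infinity type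
`(p, q)`, and `(p', q')` has the same sum at every real place and agrees with `(p, q)` at every
complex place, then `χ` also has infinity type `(p', q')` (at a real place `ι_w(x_w)` is real).
Weil 1956, §1. [cite: Weil1956, §1] -/
theorem HasInfinityType.congr_of_isReal {χ : HeckeCharacter K} {p q p' q' : InfinitePlace K → ℤ}
    (h : χ.HasInfinityType p q) (hre : ∀ w : InfinitePlace K, w.IsReal → p w + q w = p' w + q' w)
    (hp : ∀ w : InfinitePlace K, w.IsComplex → p w = p' w)
    (hq : ∀ w : InfinitePlace K, w.IsComplex → q w = q' w) :
    χ.HasInfinityType p' q' := by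
  obtain ⟨U, hU, hχU⟩ := h
  refine ⟨U, hU, fun x hx => ?_⟩
  rw [hχU x hx, HeckeCharacter.archFactor_apply, HeckeCharacter.archFactor_apply]
  refine Finset.prod_congr rfl fun w _ => ?_
  rcases w.isReal_or_isComplex with hw | hw
  · have hz : extensionEmbedding w ((x : InfiniteAdeleRing K) w) ≠ 0 :=
      InfiniteIdele.extensionEmbedding_apply_ne_zero x w
    have hreal : conj (extensionEmbedding w ((x : InfiniteAdeleRing K) w)) =
        extensionEmbedding w ((x : InfiniteAdeleRing K) w) := by
      rw [← extensionEmbeddingOfIsReal_apply hw, Complex.conj_ofReal]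
    rw [hreal, ← zpow_add₀ hz, ← zpow_add₀ hz, ← neg_add, ← neg_add, hre w hw]
  · rw [hp w hw, hq w hw]

variable (K) in
/-- **The norm character `‖·‖` has infinity type `(-1; 0 / -1)`**: `p_w = -1` at every infinite
place `w`, `q_w = 0` at real and `q_w = -1` at complex `w` (for an infinite idele with positive real
coordinates, `‖(x, 1)‖ = ∏_{w real} ι_w(x_w) · ∏_{w complex} ι_w(x_w) \overline{ι_w(x_w)}`).  This is
the computation inside the accepted `isAlgebraic_normCharacter`, with the exponents recorded.
Weil 1956; Serre 1968, Ch. II §2.3. [cite: SerreAbelianLadic1968, Ch. II §2.3] -/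
theorem hasInfinityType_normCharacter :
    (normCharacter K).HasInfinityType (fun _ => -1) (fun w => if w.IsReal then 0 else -1) := by
  set E : InfinitePlace K → (InfiniteAdeleRing K)ˣ → ℂ := fun w x =>
    extensionEmbedding w ((x : InfiniteAdeleRing K) w) with hE
  have hEcont : ∀ w, Continuous (E w) := fun w =>
    (isometry_extensionEmbedding w).continuous.comp ((continuous_apply w).comp Units.continuous_val)
  have hEnorm : ∀ w x, ‖E w x‖ = ‖(x : InfiniteAdeleRing K) w‖ := fun w x =>
    (isometry_extensionEmbedding w).norm_map_of_map_zero (map_zero _) _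
  -- the neighbourhood: positive real coordinates
  set U : Set (InfiniteAdeleRing K)ˣ := {x | ∀ w : InfinitePlace K, w.IsReal → 0 < (E w x).re}
    with hU
  have hUopen : IsOpen U := by
    have : U = ⋂ w : InfinitePlace K, {x | w.IsReal → 0 < (E w x).re} := by
      ext x; simp [hU]
    rw [this]
    refine isOpen_iInter_of_finite fun w => ?_
    by_cases hw : w.IsReal
    · have : {x : (InfiniteAdeleRing K)ˣ | w.IsReal → 0 < (E w x).re} =
          (fun x => (E w x).re) ⁻¹' Set.Ioi 0 := by
        ext x; simp [hw]
      rw [this]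
      exact isOpen_Ioi.preimage (Complex.continuous_re.comp (hEcont w))
    · have : {x : (InfiniteAdeleRing K)ˣ | w.IsReal → 0 < (E w x).re} = Set.univ := by
        ext x; simp [hw]
      rw [this]
      exact isOpen_univ
  have hUone : (1 : (InfiniteAdeleRing K)ˣ) ∈ U := fun w _ => by
    simp only [hE, Units.val_one]
    rw [show (1 : InfiniteAdeleRing K) w = 1 from rfl, map_one, Complex.one_re]
    exact one_pos
  refine ⟨U, hUopen.mem_nhds hUone, fun x hx => ?_⟩
  rw [HeckeCharacter.normCharacter_apply, HeckeCharacter.ideleNorm_infiniteIdeles,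
    Complex.ofReal_prod, HeckeCharacter.archFactor_apply]
  refine Finset.prod_congr rfl fun w _ => ?_
  change ((‖(x : InfiniteAdeleRing K) w‖ ^ w.mult : ℝ) : ℂ) =
    E w x ^ (-(-1 : ℤ)) * conj (E w x) ^ (-(if w.IsReal then (0 : ℤ) else -1))
  rw [Complex.ofReal_pow, ← hEnorm w x, neg_neg, zpow_one]
  by_cases hw : w.IsReal
  · rw [mult, if_pos hw, if_pos hw, neg_zero, zpow_zero, mul_one, pow_one]
    have hreal : ((extensionEmbeddingOfIsReal hw ((x : InfiniteAdeleRing K) w) : ℝ) : ℂ) = E w x :=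
      extensionEmbeddingOfIsReal_apply hw _
    have hpos : 0 < (E w x).re := hx w hw
    rw [← hreal] at hpos ⊢
    rw [Complex.ofReal_re] at hpos
    rw [Complex.norm_real, Real.norm_eq_abs, abs_of_pos hpos]
  · rw [mult, if_neg hw, if_neg hw, neg_neg, zpow_one, Complex.mul_conj']

/-- **All embedding exponents equal `n₀` ⟹ `χ · ‖·‖^{n₀}` has infinity type `(0, 0)`.**  With
`n_φ = embExponent p q φ`: at a real place `w`, `n_{σ_w} = p_w + q_w = n₀`; at a complex place,
`n_{σ_w} = p_w = n₀` and `n_{σ̄_w} = q_w = n₀`; `‖·‖` has type `(-1; 0 / -1)` and types add, so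
`χ ‖·‖^{n₀}` has type `(p - n₀; q / q - n₀)`, i.e. `(0, 0)` (at a real place only `p_w + q_w`
matters).  Weil 1956, §1. [cite: Weil1956, §1] [cite: Patrikis2019, Lemma 2.2.4] -/
theorem HasInfinityType.mul_normCharacter_zpow_of_embExponent_eq {χ : HeckeCharacter K}
    {p q : InfinitePlace K → ℤ} (h : χ.HasInfinityType p q) {n₀ : ℤ}
    (hn : ∀ φ : K →+* ℂ, embExponent p q φ = n₀) :
    (χ * normCharacter K ^ n₀).HasInfinityType 0 0 := by
  -- exponents at real and complex places
  have hre : ∀ w : InfinitePlace K, w.IsReal → p w + q w = n₀ := fun w hw => by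
    have hφ : ComplexEmbedding.IsReal w.embedding := isReal_iff.1 hw
    have h1 := hn w.embedding
    unfold embExponent at h1
    rwa [if_pos hφ, mk_embedding] at h1
  have hcx : ∀ w : InfinitePlace K, w.IsComplex → p w = n₀ ∧ q w = n₀ := fun w hw => by
    have hφ : ¬ ComplexEmbedding.IsReal w.embedding := isReal_iff.not.1 (not_isReal_iff_isComplex.2 hw)
    have h1 := hn w.embedding
    have h2 := hn (ComplexEmbedding.conjugate w.embedding)
    unfold embExponent at h1 h2
    rw [if_neg hφ, mk_embedding, if_pos rfl] at h1
    have hφ' : ¬ ComplexEmbedding.IsReal (ComplexEmbedding.conjugate w.embedding) :=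
      ComplexEmbedding.isReal_conjugate_iff.not.2 hφ
    have hne : ComplexEmbedding.conjugate w.embedding ≠ w.embedding := fun heq =>
      hφ (ComplexEmbedding.isReal_iff.2 heq)
    rw [if_neg hφ', mk_conjugate_eq, mk_embedding, if_neg hne] at h2
    exact ⟨h1, h2⟩
  refine (h.mul ((hasInfinityType_normCharacter K).zpow n₀)).congr_of_isReal
    (fun w hw => ?_) (fun w hw => ?_) (fun w hw => ?_)
  · simp only [Pi.add_apply, Pi.zero_apply, if_pos hw]
    linarith [hre w hw]
  · simp only [Pi.add_apply, Pi.zero_apply]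
    linarith [(hcx w hw).1]
  · simp only [Pi.add_apply, Pi.zero_apply, if_neg (not_isReal_iff_isComplex.mpr hw)]
    linarith [(hcx w hw).2]

/-- **The Größencharakter of a Hecke character of type `(0, 0)` is a ray class character modulo any
module of definition** (Neukirch VII (6.9): the Größencharaktere `mod 𝔪` trivial on `𝐑^*_{(+)}` are
the Dirichlet characters `mod 𝔪`): `|χ(ϖ_𝔭)|² = N𝔭^0 = 1` off `𝔪`
(`HasInfinityType.norm_valueAtUniformizer_sq` at weight `0`) and `χ̃((b)) = χ̃((c))` for `b ≡ c mod 𝔪`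
(`HasInfinityType.idealPow_span_eq` with archimedean factor `1`).
[cite: NeukirchANT1999, Ch. VII §6 Prop. (6.9) and Cor. (6.14)] -/
theorem HasInfinityType.isRayClassCharacter_of_isModulus_zero {χ : HeckeCharacter K}
    (hinf : χ.HasInfinityType 0 0) {T : Finset (HeightOneSpectrum (𝓞 K))}
    {e : HeightOneSpectrum (𝓞 K) → ℕ} (hmod : IsModulus χ T e) :
    Literature.NumberTheory.LFunctions.IsRayClassCharacter (modulusIdeal T e)
      (fun v => χ.valueAtUniformizer v) := by
  -- the proof of `isRayClassCharacter_of_isModulus_of_hasInfinityType_zero` of the prover-side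
  -- file `Summits/Langlands/.../IrreducibilityBySelfDualityReciprocityUpToIrreducibilityHeckeTypeZeroFiniteOrder`
  refine ⟨fun v hv => ?_, fun b c hb hc hcop hbc hpos => ?_⟩
  · have hvT : v ∉ T := fun h => hv (modulusIdeal_le_iff.mpr h)
    have h := hinf.norm_valueAtUniformizer_sq hmod (wt := 0) (fun w => by simp) hvT
    rw [zpow_zero] at h
    exact (pow_eq_one_iff_of_nonneg (norm_nonneg _) two_ne_zero).mp h
  · have h := hinf.idealPow_span_eq hmod hb hc hcop hbc hpos
    simpa only [Pi.zero_apply, zpow_zero, mul_one, Finset.prod_const_one] using h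

/-- **A Hecke character with trivial infinity type `(0, 0)` has finite order** (Neukirch VII (6.9),
(6.14)): with a module of definition `(T, e)` (`exists_isModulus`), `𝔭 ↦ χ(ϖ_𝔭)` is a character of
the finite ray class group modulo `𝔪(T, e)`, whence one exponent `N ≥ 1` with `χ(ϖ_𝔭)^N = 1` for
all `𝔭 ∤ 𝔪` (`exists_pos_forall_pow_eq_one_of_isRayClassCharacter`); so `(χ^N)(ϖ_𝔭) = 1` for all
`𝔭 ∉ T` and `χ^N = 1` by rigidity (`eq_one_of_eventually_valueAtUniformizer_eq_one`).
[cite: NeukirchANT1999, Ch. VII §6 Prop. (6.9) and Cor. (6.14)] -/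
theorem HasInfinityType.isFiniteOrder_of_zero {χ : HeckeCharacter K} (hinf : χ.HasInfinityType 0 0) :
    χ.IsFiniteOrder := by
  obtain ⟨T, e, hmod⟩ := χ.exists_isModulus
  obtain ⟨N, hN, hpow⟩ := exists_pos_forall_pow_eq_one_of_isRayClassCharacter
    (modulusIdeal_ne_bot T e) (hinf.isRayClassCharacter_of_isModulus_zero hmod)
  refine isOfFinOrder_iff_pow_eq_one.mpr ⟨N, hN, ?_⟩
  refine eq_one_of_eventually_valueAtUniformizer_eq_one
    (T.eventually_cofinite_notMem.mono fun v hvT => ?_)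
  have h1 := hpow v fun h => hvT (modulusIdeal_le_iff.mp h)
  simp only [valueAtUniformizer, localComponent_apply, pow_apply, Units.val_pow_eq_pow_val] at h1 ⊢
  exact h1

/-- **All embedding exponents equal `n₀` ⟹ there is `N ≥ 1` with `(χ(ϖ_w) · (N w)^{-n₀})^N = 1` at
every finite place `w`**: `χ ‖·‖^{n₀}` has type `(0, 0)`, hence finite order `N`, and
`‖ϖ_w‖ = (N w)⁻¹` (`valueAtUniformizer_normCharacter`). [cite: Weil1956, §1]
[cite: NeukirchANT1999, Ch. VII §6 Cor. (6.14)] -/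
theorem HasInfinityType.exists_pow_valueAtUniformizer_mul_eq_one_of_embExponent_eq
    {χ : HeckeCharacter K} {p q : InfinitePlace K → ℤ} (h : χ.HasInfinityType p q) {n₀ : ℤ}
    (hn : ∀ φ : K →+* ℂ, embExponent p q φ = n₀) :
    ∃ N : ℕ, 0 < N ∧ ∀ w : HeightOneSpectrum (𝓞 K),
      (χ.valueAtUniformizer w * ((w.residueCard : ℂ) ^ n₀)⁻¹) ^ N = 1 := by
  have hfin := (h.mul_normCharacter_zpow_of_embExponent_eq hn).isFiniteOrder_of_zero
  obtain ⟨N, hN, hone⟩ := (isOfFinOrder_iff_pow_eq_one.mp hfin)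
  refine ⟨N, hN, fun w => ?_⟩
  have hNw := valueAtUniformizer_normCharacter (K := K) w
  have h1 := congrArg (fun ψ : HeckeCharacter K => ψ.valueAtUniformizer w) hone
  simp only [valueAtUniformizer, localComponent_apply, pow_apply, mul_apply, one_apply,
    Units.val_pow_eq_pow_val, Units.val_mul, Units.val_one, zpow_apply,
    Units.val_zpow_eq_zpow_val] at h1 hNw ⊢
  rw [hNw, inv_zpow'] at h1
  rw [← zpow_neg]
  exact h1

end HeckeCharacter

/-! ### §7 The `ℓ`-adic character of a Hecke character with parallel exponents is `ε_ℓ^{-n₀}` up to a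
character of finite image -/

section Global

open scoped Classical
open NumberField IsDedekindDomain Filter
open Literature.NumberTheory.LFunctions Literature.NumberTheory.LFunctions.NumberField

variable {K : Type} [Field K] [NumberField K] {ℓ : ℕ} [Fact ℓ.Prime]

/-- The characteristic polynomial of a `1 × 1` matrix. [folklore] -/
private theorem charpoly_fin_one {A : Type*} [CommRing A] (M : Matrix (Fin 1) (Fin 1) A) :
    M.charpoly = X - C (M 0 0) := by
  rw [Matrix.charpoly, Matrix.det_fin_one, Matrix.charmatrix_apply_eq]

/-- **Rank-one rigidity with parallel weight** (Serre 1968, Ch. III §2.3 with §3; Patrikis 2019,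
proof of Cor. 2.2.3 and Lemma 2.2.4): let `θ : Γ_K → GL₁(ℚ̄_ℓ)` be a continuous character with
`θ(Frob_w^{arith}) = ι⁻¹(χ(ϖ_w))⁻¹` at almost all `w`, for a Hecke character `χ` of infinity type
`(p, q)` all of whose embedding exponents equal `n₀`, and let `ε = ε_ℓ^{n₀}` (values in `ℚ̄_ℓˣ`).
Then **`θ ⊗ ε` has finite image.**  Indeed `χ ‖·‖^{n₀}` has finite order `N`
(`HasInfinityType.exists_pow_valueAtUniformizer_mul_eq_one_of_embExponent_eq`), so
`det (θ ⊗ ε)(Frob_w)^N = (ι⁻¹(χ(ϖ_w))⁻¹ (N w)^{n₀})^N = 1` at almost all `w`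
(`ε(Frob_w) = (N w)^{n₀}`, `coe_apply_of_isArithFrobAt_of_cyclotomic_zpow`); by Frobenius rigidity
along a density-one set (`MonoidHom.eq_one_of_frobenius_eq_one_of_hasDirichletDensity_one`)
`det (θ ⊗ ε)^N = 1` on all of `Γ_K`, and the `N`-th roots of unity in `ℚ̄_ℓ` are finite in number.
[cite: SerreAbelianLadic1968, Ch. III §2.3 and §3] [cite: Patrikis2019, Cor. 2.2.3 (proof) and Lemma 2.2.4] -/
theorem FramedGaloisRep.finite_range_twist_of_hasFrobCharpolyAt_of_embExponent_eq
    (θ : FramedGaloisRep K (PadicAlgCl ℓ) 1) (ι : PadicAlgCl ℓ ≃+* ℂ) (χ : HeckeCharacter K)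
    (p q : InfinitePlace K → ℤ) (hχ : χ.HasInfinityType p q)
    (hθ : ∀ᶠ w : HeightOneSpectrum (𝓞 K) in cofinite,
      θ.HasFrobCharpolyAt w (X - C (ι.symm (χ.valueAtUniformizer w)⁻¹)))
    {n₀ : ℤ} (hn : ∀ φ : K →+* ℂ, HeckeCharacter.embExponent p q φ = n₀)
    (ε : absoluteGaloisGroup K →ₜ* (PadicAlgCl ℓ)ˣ)
    (hε : ∀ σ, (ε σ : PadicAlgCl ℓ) =
      (algebraMap ℚ_[ℓ] (PadicAlgCl ℓ) ((GaloisRep.cyclotomicCharacter K ℓ σ : ℤ_[ℓ]ˣ) : ℤ_[ℓ])) ^ n₀) :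
    (Set.range (FramedRep.twist θ ε)).Finite := by
  obtain ⟨N, hN, hroot⟩ := hχ.exists_pow_valueAtUniformizer_mul_eq_one_of_embExponent_eq hn
  set θ₀ : FramedGaloisRep K (PadicAlgCl ℓ) 1 := FramedRep.twist θ ε with hθ₀
  -- the good places: Frobenius polynomial as prescribed and `w ∤ ℓ`; a density-one set
  set 𝓛 : Set (HeightOneSpectrum (𝓞 K)) :=
    {w | θ.HasFrobCharpolyAt w (X - C (ι.symm (χ.valueAtUniformizer w)⁻¹)) ∧
      ((ℓ : ℕ) : 𝓞 K) ∉ w.asIdeal} with h𝓛def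
  have h𝓛 : HasDirichletDensity K 𝓛 1 := by
    refine hasDirichletDensity_one_of_cofinite ?_
    have hev : ∀ᶠ w : HeightOneSpectrum (𝓞 K) in cofinite, w ∈ 𝓛 :=
      hθ.and (eventually_natCast_not_mem_asIdeal (K := K) (p := ℓ) (Fact.out : ℓ.Prime).ne_zero)
    rwa [Filter.eventually_cofinite] at hev
  -- `f = det(θ₀)^N` kills the Frobenii over `𝓛`
  set f : absoluteGaloisGroup K →* (PadicAlgCl ℓ)ˣ :=
    (powMonoidHom N).comp (FramedRep.det θ₀).toMonoidHom with hfdef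
  have hfcont : Continuous f := (continuous_pow N).comp (FramedRep.det θ₀).continuous
  have hf : ∀ σ, f σ = Matrix.GeneralLinearGroup.det (θ₀ σ) ^ N := fun σ => rfl
  have hfrob : ∀ w ∈ 𝓛, ∀ 𝔓 ∈ w.primesAbove, ∀ Φ : absoluteGaloisGroup K,
      IsArithFrobAt (𝓞 K) Φ 𝔓 → f Φ = 1 := by
    rintro w ⟨hw, hwℓ⟩ 𝔓 h𝔓 Φ hΦ
    -- the entry of `θ(Φ)` and the value of `ε(Φ)`
    have hc : ((θ Φ : GL (Fin 1) (PadicAlgCl ℓ)) : Matrix (Fin 1) (Fin 1) (PadicAlgCl ℓ)) 0 0 =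
        ι.symm (χ.valueAtUniformizer w)⁻¹ := by
      have h := hw 𝔓 h𝔓 Φ hΦ
      rwa [FramedRep.charpoly, charpoly_fin_one, sub_right_inj, Polynomial.C_inj] at h
    have hεΦ : (ε Φ : PadicAlgCl ℓ) = (w.residueCard : PadicAlgCl ℓ) ^ n₀ :=
      coe_apply_of_isArithFrobAt_of_cyclotomic_zpow hε hwℓ h𝔓 hΦ
    -- `(χ(ϖ_w) (N w)^{-n₀})^N = 1`, transported along `ι⁻¹` and inverted
    have hr : ((w.residueCard : PadicAlgCl ℓ) ^ n₀ * ι.symm (χ.valueAtUniformizer w)⁻¹) ^ N = 1 := by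
      have h1 := congrArg ι.symm (hroot w)
      rw [map_pow, map_one, map_mul, map_inv₀, map_zpow₀, map_natCast] at h1
      have h2 := congrArg (fun x : PadicAlgCl ℓ => x⁻¹) h1
      simp only [inv_one, ← inv_pow, mul_inv_rev, inv_inv] at h2
      rw [map_inv₀]
      exact h2
    refine Units.ext ?_
    rw [hf, Units.val_pow_eq_pow_val, hθ₀, FramedRep.det_twist_apply, pow_one, Units.val_mul,
      Matrix.GeneralLinearGroup.val_det_apply, Matrix.det_fin_one, hc, hεΦ, Units.val_one]
    exact hr
  have hone := MonoidHom.eq_one_of_frobenius_eq_one_of_hasDirichletDensity_one f hfcont h𝓛 hfrob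
  have hpowN : ∀ σ, Matrix.GeneralLinearGroup.det (θ₀ σ) ^ N = 1 := fun σ => by
    rw [← hf, hone, MonoidHom.one_apply]
  -- `det` is injective on `GL₁` and lands in the finite set of `N`-th roots of unity
  have hfinU : {u : (PadicAlgCl ℓ)ˣ | u ^ N = 1}.Finite := by
    haveI : NeZero N := ⟨hN.ne'⟩
    have h : {u : (PadicAlgCl ℓ)ˣ | u ^ N = 1} ⊆
        Set.range (fun u : rootsOfUnity N (PadicAlgCl ℓ) => (u : (PadicAlgCl ℓ)ˣ)) := fun u hu =>
      ⟨⟨u, (mem_rootsOfUnity _ _).2 hu⟩, rfl⟩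
    exact (Set.finite_range _).subset h
  refine Set.Finite.of_finite_image
    (f := fun g : GL (Fin 1) (PadicAlgCl ℓ) => Matrix.GeneralLinearGroup.det g)
    (hfinU.subset ?_) ?_
  · rintro _ ⟨_, ⟨σ, rfl⟩, rfl⟩
    exact hpowN σ
  · intro g _ g' _ hgg'
    have h := congrArg (fun u : (PadicAlgCl ℓ)ˣ => (u : PadicAlgCl ℓ)) hgg'
    simp only [Matrix.GeneralLinearGroup.val_det_apply, Matrix.det_fin_one] at h
    refine Units.ext (Matrix.ext fun i j => ?_)
    rw [Subsingleton.elim i 0, Subsingleton.elim j 0]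
    exact h

end Global

end Literature.NumberTheory.GaloisRepresentations

/-! ### §8 The discharge -/

namespace Literature.NumberTheory.PAdicHodge

open scoped Classical
open NumberField IsDedekindDomain Filter
open Literature.NumberTheory.GaloisRepresentations

/-- The cyclotomic character is compatible with restriction to a decomposition group:
`ε_ℓ(res_v σ) = ε_ℓ(σ)` for `σ ∈ Γ_{K_v}` (accepted `cyclotomicCharacter_absGaloisRestrict`).
[cite: SerreAbelianLadic1968, Ch. I §1.2] -/
private theorem cyclotomicCharacter_absGaloisRestrict_adicCompletion {K₀ : Type} [Field K₀]
    [NumberField K₀] (ℓ : ℕ) [Fact ℓ.Prime] (v : HeightOneSpectrum (𝓞 K₀))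
    (σ : absoluteGaloisGroup (v.adicCompletion K₀)) :
    GaloisRep.cyclotomicCharacter K₀ ℓ (absGaloisRestrict K₀ (v.adicCompletion K₀) σ) =
      GaloisRep.cyclotomicCharacter (v.adicCompletion K₀) ℓ σ := by
  haveI : NeZero (ℓ : K₀) := ⟨Nat.cast_ne_zero.mpr (Fact.out : ℓ.Prime).ne_zero⟩
  exact cyclotomicCharacter_absGaloisRestrict K₀ (v.adicCompletion K₀) ℓ σ

/-- **The labelled Hodge–Tate weights of `Ind_{Γ_K}^{Γ_{K₀}} θ` for a character `θ` matching a Hecke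
character with parallel exponents `n₀` are `{n₀, …, n₀}`** — the content of
`labelledHodgeTateWeightsAt_induce_of_parallel`, for an arbitrary base number field `K₀ ⊆ K` in place
of `ℚ`.  Proof: `θ₀ = θ ⊗ ε_ℓ^{n₀}` has finite image
(`finite_range_twist_of_hasFrobCharpolyAt_of_embExponent_eq`); by the projection formula
`Ind(θ) = Ind(θ₀ ⊗ ε_ℓ^{-n₀}|_{Γ_K}) = D (Ind(θ₀) ⊗ ε_ℓ^{-n₀}) D⁻¹ = (D Ind(θ₀) D⁻¹) ⊗ ε_ℓ^{-n₀}`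
(`induce_twist_comp_eq_conj`, `ε_ℓ ∘ res = ε_ℓ`); Tate twists shift the labelled weights of THE datum
(`labelledHodgeTateWeightsAt_twist_of_cyclotomic_zpow`), and finite-image representations have all
labelled weights `0` for it (`labelledHodgeTateWeightsAt_eq_replicate_zero_of_finite_range`).
[cite: Patrikis2019, Cor. 2.2.3 (proof), Lemma 2.2.4 and Lemma 7.2.1 (numbering of arXiv:1207.6724)]
[cite: SerreAbelianLadic1968, Ch. III §1.1, §2.3 and App. A.5] -/
theorem labelledHodgeTateWeightsAt_induce_eq_replicate_of_embExponent_eq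
    {K₀ : Type} [Field K₀] [NumberField K₀] {K : Type} [Field K] [NumberField K] [Algebra K₀ K]
    [FiniteDimensional K₀ K] {d : ℕ} (hd : Module.finrank K₀ K = d) {ℓ : ℕ} [Fact ℓ.Prime]
    (θ : FramedGaloisRep K (PadicAlgCl ℓ) 1) (ι : PadicAlgCl ℓ ≃+* ℂ) (χ : HeckeCharacter K)
    (p q : InfinitePlace K → ℤ) (hχ : χ.HasInfinityType p q)
    (hθ : ∀ᶠ w : HeightOneSpectrum (𝓞 K) in cofinite,
      θ.HasFrobCharpolyAt w (X - C (ι.symm (χ.valueAtUniformizer w)⁻¹)))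
    {n₀ : ℤ} (hn : ∀ φ : K →+* ℂ, HeckeCharacter.embExponent p q φ = n₀)
    (v : HeightOneSpectrum (𝓞 K₀)) (hv : ((ℓ : ℕ) : 𝓞 K₀) ∈ v.asIdeal)
    (τ : v.adicCompletion K₀ →+* PadicAlgCl ℓ) (hτ : Continuous τ) :
    (θ.induce K₀ hd).labelledHodgeTateWeightsAt v (fontainePstAdicCompletion v ℓ hv).algebra
      (fontainePstAdicCompletion v ℓ hv).𝔅 τ = Multiset.replicate (d * 1) n₀ := by
  haveI : NeZero (ℓ : K₀) := ⟨Nat.cast_ne_zero.mpr (Fact.out : ℓ.Prime).ne_zero⟩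
  -- `ε_ℓ^{n₀}` on `Γ_{K₀}` and its restriction to `Γ_K`
  obtain ⟨ε₀, hε₀⟩ := exists_cyclotomicCharacter_padicAlgCl_zpow K₀ ℓ n₀
  set εK : absoluteGaloisGroup K →ₜ* (PadicAlgCl ℓ)ˣ := ε₀.comp (absGaloisRestrict K₀ K) with hεKdef
  have hεK : ∀ σ, (εK σ : PadicAlgCl ℓ) =
      (algebraMap ℚ_[ℓ] (PadicAlgCl ℓ) ((GaloisRep.cyclotomicCharacter K ℓ σ : ℤ_[ℓ]ˣ) : ℤ_[ℓ])) ^ n₀ :=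
    fun σ => by
      show ((ε₀ (absGaloisRestrict K₀ K σ) : (PadicAlgCl ℓ)ˣ) : PadicAlgCl ℓ) = _
      rw [hε₀, cyclotomicCharacter_absGaloisRestrict K₀ K ℓ σ]
  -- `θ₀ = θ ⊗ ε_ℓ^{n₀}` has finite image, and `θ = θ₀ ⊗ ε_ℓ^{-n₀}`
  have hfin : (Set.range (FramedRep.twist θ εK)).Finite :=
    FramedGaloisRep.finite_range_twist_of_hasFrobCharpolyAt_of_embExponent_eq θ ι χ p q hχ hθ hn εK hεK
  have hθ' : θ = FramedRep.twist (FramedRep.twist θ εK) εK⁻¹ := (FramedRep.twist_twist_inv θ εK).symm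
  -- projection formula: `Ind θ = D (Ind θ₀ ⊗ ε_ℓ^{-n₀}) D⁻¹ = (D Ind θ₀ D⁻¹) ⊗ ε_ℓ^{-n₀}`
  obtain ⟨D, hD⟩ := FramedGaloisRep.induce_twist_comp_eq_conj K₀ hd (FramedRep.twist θ εK) ε₀⁻¹ εK⁻¹
    (fun σ => rfl)
  rw [hθ', hD, FramedRep.conj_twist,
    FramedGaloisRep.labelledHodgeTateWeightsAt_twist_of_cyclotomic_zpow _ ε₀⁻¹ (-n₀) v hv
      (fun σ => ?_) τ,
    FramedGaloisRep.labelledHodgeTateWeightsAt_eq_replicate_zero_of_finite_range _ v hv ?_ τ hτ,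
    Multiset.map_replicate, zero_sub, neg_neg]
  · -- `(D Ind(θ₀) D⁻¹)|_{Γ_{K₀,v}}` has finite image
    refine (FramedRep.finite_range_conj D _
      (FramedGaloisRep.finite_range_induce K₀ hd _ hfin)).subset ?_
    rintro _ ⟨σ, rfl⟩
    exact ⟨absGaloisRestrict K₀ (v.adicCompletion K₀) σ, rfl⟩
  · -- `ε₀⁻¹ ∘ res_v = ε_ℓ^{-n₀}` on `Γ_{K₀,v}`
    show (((ε₀ (absGaloisRestrict K₀ (v.adicCompletion K₀) σ))⁻¹ : (PadicAlgCl ℓ)ˣ) : PadicAlgCl ℓ) = _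
    rw [Units.val_inv_eq_inv_val, hε₀, cyclotomicCharacter_absGaloisRestrict_adicCompletion ℓ v σ,
      zpow_neg]

/-- **`labelledHodgeTateWeightsAt_induce_of_parallel` holds** (Patrikis 2019, proof of Cor. 2.2.3,
Lemma 2.2.4, Lemma 7.2.1; Serre 1968, Ch. III §1.1, §2.3, App. A.5 — for THE pinned Fontaine data).
For a number field `K` of degree `d`, a prime `ℓ`, a character `θ : Γ_K → GL₁(ℚ̄_ℓ)` with
`θ(Frob_w) = ι⁻¹(χ(ϖ_w))⁻¹` at almost all `w` for a Hecke character `χ` of infinity type `(p, q)`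
all of whose embedding exponents equal `n₀`: the `τ`-labelled Hodge–Tate weights of
`Ind_{Γ_K}^{Γ_ℚ} θ` at every `v ∣ ℓ` and every continuous `τ` are `{n₀, …, n₀}` (`d` times)
(`labelledHodgeTateWeightsAt_induce_eq_replicate_of_embExponent_eq` over the base `ℚ`).  The road:
a parallel type is a norm power up to finite order (Weil 1956; `χ ‖·‖^{n₀}` has type `(0,0)`), so
`θ ⊗ ε_ℓ^{n₀}` has finite image by Frobenius rigidity; `Ind` commutes with the twist up to a change
of frame; Tate twists shift the labelled weights; and finite-image representations have labelled
weights `0` for Fontaine's `B_dR` (`B_dR(ℚ_ℓ)^{Γ_L} ⊆ \bar ℚ_ℓ ⊆ Fil⁰ ∖ Fil¹` for finite `L/ℚ_ℓ`).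
[cite: Patrikis2019, Cor. 2.2.3 (proof), Lemma 2.2.4 and Lemma 7.2.1 (numbering of arXiv:1207.6724)]
[cite: SerreAbelianLadic1968, Ch. III §1.1, §2.3 and App. A.5]
[cite: FontaineAsterisque223III, Exp. III §1.5] -/
theorem labelledHodgeTateWeightsAt_induce_of_parallel_holds :
    labelledHodgeTateWeightsAt_induce_of_parallel := by
  intro K _ _ d hd ℓ _ θ ι χ p q hχ hθ n₀ hn
  refine ⟨n₀, fun v hv τ hτ => ?_⟩
  rw [labelledHodgeTateWeightsAt_induce_eq_replicate_of_embExponent_eq hd θ ι χ p q hχ hθ hn v hv τ hτ,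
    mul_one]

end Literature.NumberTheory.PAdicHodge

end
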